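/-
Copyright: pub-balaban β-flow team, BINDER row D4 OWNER (unit `b2b-balaban-beta-an4`).  ROW-D4 JUNCTION, SECOND LEAF: the
one-loop-split letters of `B12AsPrintedRowD4Junction` (the split RELATIVISED to the printed coupling domain) carried to
[I]'s Theorem 2 AS PRINTED on the as-printed carrier, through `EriceFlowEnclosureB12AsPrintedUpper` (β-flow prover 1) BY NAME.
Def-free bookkeeping; NOTHING of [I] is asserted or proved; (D4) is NOT discharged by anything in this file.
-/
import Summits.QuantumFields.BalabanUV.Beta.EriceFlowEnclosureB12AsPrintedUpper

/-!
# Row-D4 junction with `B12BetaAsPrinted`, leaf 2 — Theorem 2 AS PRINTED from the junction's split letters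

HONEST FRAMING (page 1 of everything the β sub-cell writes): discharging `BetaPertH` makes Bałaban's UV stability
UNCONDITIONAL — a real constructive-QFT result; it is NOT the continuum limit and NOT the Clay problem.  HONEST DEPENDENCY
(cell reorg 2026-08-19, verbatim): «continuum YM on T⁴ ⇐ BetaPertH ∧ nine spine estimates (0/9 proved); BetaPertH ⇐ (D1) ∧
(D4) ∧ CAP+tail; G-an2-4 gates asym, D1 and NE2/3/4.»  THIS MODULE DISCHARGES NOTHING.

WHY THIS LEAF.  `EriceFlowEnclosureB12AsPrintedUpper.theorem2Statement_of_split` (β-flow prover 1) derives [Balaban1987RG1]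
Theorem 2 AS PRINTED (`B12BetaAsPrinted.Theorem2Statement S hL`) from a one-loop split `T : B12Beta.OneLoopSplit S.β` plus the
letters (AF-0) `2b ≤ β⁰_{k+1}`, (AF-1) `|β¹_{k+1}| ≤ C·g_k` on ]0, γ]^{k+1}, `Cγ ≤ b`, the upper bound (U) and joint continuity (C),
and names the row-D4 junction as the supplier of the split.  The structure `B12Beta.OneLoopSplit S.β` asks `β¹_{k+1} = 0` at EVERY
history with `g_k = 0`; the as-printed interface — faithfully to print, which defines β_{j+1}(g_j) for preceding couplings in
]0, γ] only ((1.22) p. 264 with Theorem 3's «0 < g_k ≦ γ») — gives that vanishing on the printed coupling domain `histDom S.γ`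
only (`B12AsPrintedRowD4Junction.split_on_histDom`: `∃ β⁰ β¹, S.β = β⁰ + β¹ ∧ β¹ = 0` on the last-zero face of `histDom`).  So
the junction does NOT inhabit the binder `T`; this leaf records, kernel-checked, that it does not have to:

* §1 `betaLowerH_of_splitPair`, **`theorem2Statement_of_splitPair`** — the same conclusions for ANY PAIR (β⁰, β¹) with
  `S.β = β⁰ + β¹`, (AF-0), (AF-1): the field `vanish` of `OneLoopSplit` is IDLE in `theorem2Statement_of_split` (which is the
  pair statement read at `(T.β0, T.β1, T.split)` — `theorem2Statement_of_split_of_pair`).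
* §2 NO SPLIT OBJECT AT ALL: `betaLowerH_of_faceLetters`, **`theorem2Statement_of_faceLetters`** — Theorem 2 AS PRINTED from
  the printed `StandingHypotheses` ∕ `Definitions` and four LETTERS ON β ITSELF: (AF-0@face) `2b ≤ β_{k+1}(g₀, …, g_{k−1}, 0)` for
  (g₀, …, g_k) ∈ ]0, γ]^{k+1} (the one-loop numbers read AT the last-zero face — where print's (2.13)–(2.14) put them), (L@0)
  `BetaDerivClause.LastVarLipschitzAtZero S.β C γ` with `Cγ ≤ b` (row an4's LOCATED UNPRINTED k-uniform last-variable letter —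
  p. 264 prints smoothness in g_j per scale, no uniformity; its per-step, per-run shadow from print is
  `EriceFlowEnclosureB12AsPrintedUpper.lastSection_lipschitzOnWith`), (U) `FlowStep.BetaUpperH β′ γ S.β`, (C) `FlowStep.BetaContH γ S.β`.
* §3 THE JUNCTION'S SPLIT CARRIES THE LETTERS: for EVERY witness (β⁰, β¹) of `split_on_histDom` and every γ ≤ S.γ —
  `beta0_eq_face` (β⁰_{k+1} = β_{k+1} at each last-zero face point over ]0, γ]^k: (AF-0) for β⁰ ⟺ (AF-0@face)),
  `af1_of_atZero_on_histDom` ((L@0) ⟹ (AF-1) for β¹ on ]0, γ]^{k+1} — the relativised vanishing suffices because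
  `(g₀, …, g_{k−1}, 0) ∈ histDom S.γ k`; the `OneLoopSplit`-typed `BetaDerivClause.af1_of_atZero` without its `vanish`-everywhere),
  **`theorem2Statement_of_splitOnHistDom`** (END: `StandingHypotheses`, `Definitions`, any junction witness, (AF-0) on its β⁰,
  (L@0), `Cγ ≤ b`, (U), (C) ⟹ `Theorem2Statement S hL`).
* §4 WHAT THE UNIFORM READING OF p. 264 SUPPLIES: **`theorem2Statement_of_uniform264`** — with the history-explicit smoothness
  clause `B12CouplingClausesHistory.BetaSmoothInLast264 γ S.β` and the j- and history-UNIFORM reading `BetaDerivsUniformInLast264 γ S.β b·`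
  of «uniformly bounded on this interval together with all derivatives» (typed in `B12CouplingClausesHistory` §6; print does not
  decide between it and the per-scale reading), (U) is its order 0 and (L@0) its order 1 (C = b 1); so Theorem 2 AS PRINTED follows
  from the printed `Definitions` + that reading + (AF-0@face) with `b(1)·γ ≤ b` + (C).  NOT in print under any reading: (AF-0@face)
  (sign and size of the one-loop numbers; Theorem 2 is stated without proof, p. 259) and joint continuity in the EARLIER couplings
  (p. 298 says only that the dependence exists).

ROW IMPACT (BINDER-OWNERS row D4): class NONE — `Setting` is abstract, no instance of Bałaban's objects (instance 0∕1; (D4) NOT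
discharged); wiring: the consumer's Theorem-2 reduction now reads the junction's split BY NAME.  NOT supplied by print and NOT
claimed: (AF-0) in any form (no sign of β in [I]; Theorem 2 is STATED WITHOUT PROOF, p. 259), the k-uniform constant of (L@0),
the box-wide (U) (print: run prefixes only, junction §3 ∕ O-2) and (C) (print: last variable only, `c264`).

statement-level skeleton of published theorems with citation tags; proofs where landed; nothing here is a claim about the
Yang–Mills mass gap
-/

noncomputable section

namespace Summit.QuantumFields.BalabanUV.Beta.B12AsPrintedRowD4JunctionThm2

open Literature.MathematicalPhysics.QuantumFieldTheory.Balaban1983to89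
open Literature.MathematicalPhysics.QuantumFieldTheory.Balaban1983to89.B12BetaAsPrinted
open Literature.MathematicalPhysics.QuantumFieldTheory.Balaban1983to89.FlowStep (HBeta Box mem_box histBox_eq_box
  BetaContH BetaLowerH BetaUpperH)
open Literature.MathematicalPhysics.QuantumFieldTheory.Balaban1983to89.BetaDerivClause (LastVarLipschitzAtZero)
open Literature.MathematicalPhysics.QuantumFieldTheory.Balaban1983to89.B12CouplingClausesHistory (BetaSmoothInLast264
  BetaDerivsUniformInLast264 lastVarLipschitz_of_uniform betaUpperH_of_uniform)
open Summit.QuantumFields.BalabanUV.Beta.B12AsPrintedRowD4Junction (split_on_histDom)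
open Summit.QuantumFields.BalabanUV.Beta.EriceFlowEnclosureB12AsPrintedUpper (theorem2Statement_of_letters)

variable {S : Setting}

/-! ## §1 Pair-stated split letters: `OneLoopSplit.vanish` is idle -/

/-- **(AF-0) + (AF-1) ⟹ the lower letter, for any PAIR.**  If `S.β = β⁰ + β¹` pointwise, `2b ≤ β⁰_{k+1}` and
`|β¹_{k+1}(g₀, …, g_k)| ≤ C·g_k` on ]0, γ]^{k+1} with `0 ≤ C`, `Cγ ≤ b`, then `b ≤ β_{k+1}` on ]0, γ]^{k+1}
(`FlowStep.BetaLowerH b γ S.β`) — the arithmetic of `B12Beta.betaLowerHist_of_split` ∕ `FlowStep.betaLowerH_of_split` with no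
`vanish` field anywhere. [cite: Balaban1987RG1, (2.12)–(2.14) p.268] -/
theorem betaLowerH_of_splitPair {β0 : ℕ → ℝ} {β1 : HBeta} (hsplit : ∀ (k : ℕ) (p : Fin (k + 1) → ℝ), S.β k p = β0 k + β1 k p)
    {b C γ : ℝ} (hAF0 : ∀ k, 2 * b ≤ β0 k)
    (hAF1 : ∀ (k : ℕ) (p : Fin (k + 1) → ℝ), p ∈ B12Beta.HistBox γ k → |β1 k p| ≤ C * p (Fin.last k))
    (hC : 0 ≤ C) (hγ : C * γ ≤ b) : BetaLowerH b γ S.β := by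
  intro k v hv
  have hv' : v ∈ B12Beta.HistBox γ k := (histBox_eq_box γ k).symm ▸ hv
  have h1 := hAF1 k v hv'
  have hlast : v (Fin.last k) ≤ γ := (hv' (Fin.last k)).2
  have h2 : C * v (Fin.last k) ≤ C * γ := mul_le_mul_of_nonneg_left hlast hC
  have h3 : -(C * v (Fin.last k)) ≤ β1 k v := (abs_le.mp h1).1
  rw [hsplit k v]
  linarith [hAF0 k]

/-- `b ≤ β′` whenever a lower letter `b` and an upper letter `β′` hold on the same nonempty box family (evaluate both at the
constant history γ of length 1). [folklore] -/
theorem lower_le_upper {b β' γ : ℝ} (hγ0 : 0 < γ) (hLo : BetaLowerH b γ S.β) (hU : BetaUpperH β' γ S.β) : b ≤ β' := by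
  have hmem : (fun _ : Fin (0 + 1) => γ) ∈ Box γ 0 := mem_box.mpr fun _ => ⟨hγ0, le_rfl⟩
  exact (hLo 0 _ hmem).trans (hU 0 _ hmem)

/-- **THEOREM 2 AS PRINTED FROM PAIR-STATED SPLIT LETTERS.**  For a setting with p. 251's ∕ Theorem 3's standing hypotheses and
the printed `Definitions` ((0.18), (0.20)): ANY pair (β⁰, β¹) with `S.β = β⁰ + β¹`, (AF-0) `2b ≤ β⁰_{k+1}` (b > 0), (AF-1)
`|β¹_{k+1}| ≤ C·g_k` on ]0, γ]^{k+1}, `0 ≤ C`, `Cγ ≤ b`, the upper letter (U) and joint continuity (C) on the boxes give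
`Theorem2Statement S hL` — `EriceFlowEnclosureB12AsPrintedUpper.theorem2Statement_of_letters` fed by `betaLowerH_of_splitPair`.
No vanishing of β¹ is used: (AF-1) already carries it.  A REDUCTION; (AF-0)∕(AF-1)∕(U) box-wide∕(C) are NOT printed.
[cite: Balaban1987RG1, Thm 2 (0.31) p.259 with (2.12)–(2.14) p.268] -/
theorem theorem2Statement_of_splitPair (hH : StandingHypotheses S) (hD : Definitions S) {β0 : ℕ → ℝ} {β1 : HBeta}
    (hsplit : ∀ (k : ℕ) (p : Fin (k + 1) → ℝ), S.β k p = β0 k + β1 k p) {b C γ β' : ℝ} (hγ0 : 0 < γ) (hb : 0 < b)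
    (hAF0 : ∀ k, 2 * b ≤ β0 k)
    (hAF1 : ∀ (k : ℕ) (p : Fin (k + 1) → ℝ), p ∈ B12Beta.HistBox γ k → |β1 k p| ≤ C * p (Fin.last k))
    (hC : 0 ≤ C) (hγ : C * γ ≤ b) (hU : BetaUpperH β' γ S.β) (hcont : BetaContH γ S.β) :
    Theorem2Statement S (hL_of_standing hH) :=
  have hLo : BetaLowerH b γ S.β := betaLowerH_of_splitPair hsplit hAF0 hAF1 hC hγ
  theorem2Statement_of_letters hH hD hγ0 hb (lower_le_upper hγ0 hLo hU) hcont hLo hU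

/-- The consumer's `theorem2Statement_of_split` is the pair statement read at `(T.β0, T.β1, T.split)`: the field `T.vanish`
(β¹ = 0 at EVERY last-zero history, on or off the printed coupling domain) is idle there. [cite: Balaban1987RG1, Thm 2 p.259 with (2.12)–(2.14) p.268] -/
theorem theorem2Statement_of_split_of_pair (hH : StandingHypotheses S) (hD : Definitions S) (T : B12Beta.OneLoopSplit S.β)
    {b C γ β' : ℝ} (hγ0 : 0 < γ) (hb : 0 < b) (hAF0 : ∀ k, 2 * b ≤ T.β0 k)
    (hAF1 : ∀ (k : ℕ) (p : Fin (k + 1) → ℝ), p ∈ B12Beta.HistBox γ k → |T.β1 k p| ≤ C * p (Fin.last k))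
    (hC : 0 ≤ C) (hγ : C * γ ≤ b) (hU : BetaUpperH β' γ S.β) (hcont : BetaContH γ S.β) :
    Theorem2Statement S (hL_of_standing hH) :=
  theorem2Statement_of_splitPair hH hD T.split hγ0 hb hAF0 hAF1 hC hγ hU hcont

/-! ## §2 No split object at all: the letters read on β itself -/

/-- **The lower letter from two letters on β itself.**  (AF-0@face) `2b ≤ β_{k+1}(g₀, …, g_{k−1}, 0)` for every
(g₀, …, g_k) ∈ ]0, γ]^{k+1} and (L@0) `|β_{k+1}(g₀, …, g_k) − β_{k+1}(g₀, …, g_{k−1}, 0)| ≤ C·g_k` there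
(`BetaDerivClause.LastVarLipschitzAtZero S.β C γ`, row an4's located unprinted k-uniform letter), with `0 ≤ C`, `Cγ ≤ b`, give
`b ≤ β_{k+1}` on ]0, γ]^{k+1}.  Elementary. [cite: Balaban1987RG1, §1 p.264 with (2.12)–(2.14) p.268] -/
theorem betaLowerH_of_faceLetters {b C γ : ℝ}
    (hAF0 : ∀ (k : ℕ) (p : Fin (k + 1) → ℝ), p ∈ B12Beta.HistBox γ k →
      2 * b ≤ S.β k (Function.update p (Fin.last k) 0))
    (hLip : LastVarLipschitzAtZero S.β C γ) (hC : 0 ≤ C) (hγ : C * γ ≤ b) : BetaLowerH b γ S.β := by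
  intro k v hv
  have hv' : v ∈ B12Beta.HistBox γ k := (histBox_eq_box γ k).symm ▸ hv
  have h1 := hLip k v hv'
  have hlast : v (Fin.last k) ≤ γ := (hv' (Fin.last k)).2
  have h2 : C * v (Fin.last k) ≤ C * γ := mul_le_mul_of_nonneg_left hlast hC
  have h3 : -(C * v (Fin.last k)) ≤ S.β k v - S.β k (Function.update v (Fin.last k) 0) := (abs_le.mp h1).1
  linarith [hAF0 k v hv']

/-- **THEOREM 2 AS PRINTED WITH NO SPLIT OBJECT.**  For a setting with the standing hypotheses and the printed `Definitions`:
(AF-0@face) + (L@0) with `Cγ ≤ b` (b > 0, 0 ≤ C) + (U) + (C) on the boxes ]0, γ]^{k+1} ⟹ `Theorem2Statement S hL`.  The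
one-loop split of print ((1.3)∕(1.6), (2.13)–(2.14)) is a PRESENTATION of these letters: β⁰_{k+1} is β_{k+1} at the last-zero
face (`B12AsPrintedRowD4Junction.beta_eq_of_lastZero`), β¹ the difference.  A REDUCTION; none of the four letters is printed
box-wide, and (AF-0@face) — the sign and size of the one-loop numbers — not at all. [cite: Balaban1987RG1, Thm 2 (0.31) p.259 with §1 p.264] -/
theorem theorem2Statement_of_faceLetters (hH : StandingHypotheses S) (hD : Definitions S) {b C γ β' : ℝ} (hγ0 : 0 < γ)
    (hb : 0 < b)
    (hAF0 : ∀ (k : ℕ) (p : Fin (k + 1) → ℝ), p ∈ B12Beta.HistBox γ k →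
      2 * b ≤ S.β k (Function.update p (Fin.last k) 0))
    (hLip : LastVarLipschitzAtZero S.β C γ) (hC : 0 ≤ C) (hγ : C * γ ≤ b) (hU : BetaUpperH β' γ S.β)
    (hcont : BetaContH γ S.β) : Theorem2Statement S (hL_of_standing hH) :=
  have hLo : BetaLowerH b γ S.β := betaLowerH_of_faceLetters hAF0 hLip hC hγ
  theorem2Statement_of_letters hH hD hγ0 hb (lower_le_upper hγ0 hLo hU) hcont hLo hU

/-! ## §3 The junction's relativised split carries the letters -/

/-- For a history in ]0, γ]^{k+1} with γ ≤ S.γ, its last-zero face point (g₀, …, g_{k−1}, 0) lies in the printed coupling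
domain `histDom S.γ k` and has last coupling 0 (bookkeeping). [cite: Balaban1987RG1, p.264 (β-clause after (1.22)) with Thm 3 p.264] -/
theorem update_last_zero_mem_histDom {γ : ℝ} (hγS : γ ≤ S.γ) {k : ℕ} {p : Fin (k + 1) → ℝ}
    (hp : p ∈ B12Beta.HistBox γ k) :
    Function.update p (Fin.last k) 0 ∈ histDom S.γ k ∧ Function.update p (Fin.last k) 0 (Fin.last k) = 0 := by
  have hγ : 0 ≤ S.γ := le_trans (le_trans (hp (Fin.last k)).1.le (hp (Fin.last k)).2) hγS
  refine ⟨⟨fun i hi => ?_, ?_, ?_⟩, by simp⟩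
  · rw [Function.update_of_ne hi]
    exact ⟨(hp i).1, (hp i).2.trans hγS⟩
  · simp
  · simpa using hγ

/-- **β⁰ IS β AT THE FACE.**  For every witness (β⁰, β¹) of the junction's `split_on_histDom` (split everywhere, β¹ = 0 on the
last-zero face of `histDom S.γ`) and every history in ]0, γ]^{k+1}, γ ≤ S.γ: `β⁰_{k+1} = β_{k+1}(g₀, …, g_{k−1}, 0)`.  Hence
(AF-0) for β⁰ and (AF-0@face) of §2 are the same letter on these boxes. [cite: Balaban1987RG1, (2.13)–(2.14) p.268] -/
theorem beta0_eq_face {β0 : ℕ → ℝ} {β1 : HBeta} (hsplit : ∀ (k : ℕ) (p : Fin (k + 1) → ℝ), S.β k p = β0 k + β1 k p)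
    (hvan : ∀ (k : ℕ) (p : Fin (k + 1) → ℝ), p ∈ histDom S.γ k → p (Fin.last k) = 0 → β1 k p = 0)
    {γ : ℝ} (hγS : γ ≤ S.γ) {k : ℕ} {p : Fin (k + 1) → ℝ} (hp : p ∈ B12Beta.HistBox γ k) :
    β0 k = S.β k (Function.update p (Fin.last k) 0) := by
  obtain ⟨hD, h0⟩ := update_last_zero_mem_histDom hγS hp
  rw [hsplit k _, hvan k _ hD h0, add_zero]

/-- **(L@0) ⟹ (AF-1) FOR THE JUNCTION'S β¹.**  For every witness (β⁰, β¹) of `split_on_histDom` and γ ≤ S.γ: row an4's letter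
`LastVarLipschitzAtZero S.β C γ` gives `|β¹_{k+1}(g₀, …, g_k)| ≤ C·g_k` on ]0, γ]^{k+1} — `BetaDerivClause.af1_of_atZero` with the
vanishing needed ONLY on the printed coupling domain (the face point of a box history lies in `histDom S.γ`).
[cite: Balaban1987RG1, (2.12)–(2.14) p.268 with §1 p.264] -/
theorem af1_of_atZero_on_histDom {β0 : ℕ → ℝ} {β1 : HBeta}
    (hsplit : ∀ (k : ℕ) (p : Fin (k + 1) → ℝ), S.β k p = β0 k + β1 k p)
    (hvan : ∀ (k : ℕ) (p : Fin (k + 1) → ℝ), p ∈ histDom S.γ k → p (Fin.last k) = 0 → β1 k p = 0)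
    {C γ : ℝ} (hγS : γ ≤ S.γ) (hLip : LastVarLipschitzAtZero S.β C γ) :
    ∀ (k : ℕ) (p : Fin (k + 1) → ℝ), p ∈ B12Beta.HistBox γ k → |β1 k p| ≤ C * p (Fin.last k) := by
  intro k p hp
  have hL := hLip k p hp
  obtain ⟨hD, h0⟩ := update_last_zero_mem_histDom hγS hp
  have hdiff : S.β k p - S.β k (Function.update p (Fin.last k) 0) = β1 k p := by
    rw [hsplit k p, hsplit k (Function.update p (Fin.last k) 0), hvan k _ hD h0]; ring
  rwa [hdiff] at hL

/-- **END — THEOREM 2 AS PRINTED FROM THE JUNCTION'S SPLIT.**  For a setting with the standing hypotheses and the printed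
`Definitions`, EVERY witness (β⁰, β¹) of `B12AsPrintedRowD4Junction.split_on_histDom` (such witnesses exist from `Definitions`
alone), a box size `0 < γ ≤ S.γ`, (AF-0) `2b ≤ β⁰_{k+1}` (b > 0), row an4's (L@0) `LastVarLipschitzAtZero S.β C γ` with `0 ≤ C`,
`Cγ ≤ b`, the upper letter (U) and joint continuity (C) on ]0, γ]^{k+1} ⟹ `Theorem2Statement S hL`.  This is what the consumer's
`theorem2Statement_of_split` says once its binder is the split the interface actually supplies.  A REDUCTION — (AF-0), the
k-uniform (L@0), the box-wide (U) and (C) are located unprinted inputs; nothing of [I] asserted; (D4) NOT discharged.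
[cite: Balaban1987RG1, Thm 2 (0.31) p.259 with (2.12)–(2.14) p.268 and §1 p.264] -/
theorem theorem2Statement_of_splitOnHistDom (hH : StandingHypotheses S) (hD : Definitions S) {β0 : ℕ → ℝ} {β1 : HBeta}
    (hsplit : ∀ (k : ℕ) (p : Fin (k + 1) → ℝ), S.β k p = β0 k + β1 k p)
    (hvan : ∀ (k : ℕ) (p : Fin (k + 1) → ℝ), p ∈ histDom S.γ k → p (Fin.last k) = 0 → β1 k p = 0)
    {b C γ β' : ℝ} (hγ0 : 0 < γ) (hγS : γ ≤ S.γ) (hb : 0 < b) (hAF0 : ∀ k, 2 * b ≤ β0 k)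
    (hLip : LastVarLipschitzAtZero S.β C γ) (hC : 0 ≤ C) (hγ : C * γ ≤ b) (hU : BetaUpperH β' γ S.β)
    (hcont : BetaContH γ S.β) : Theorem2Statement S (hL_of_standing hH) :=
  theorem2Statement_of_splitPair hH hD hsplit hγ0 hb hAF0 (af1_of_atZero_on_histDom hsplit hvan hγS hLip) hC hγ hU
    hcont


/-! ## §4 What the UNIFORM READING of p. 264's clause supplies: (U) and (L@0) -/

/-- **MODULO THE UNIFORM READING OF p. 264, THEOREM 2 AS PRINTED REDUCES TO THE SIGN∕SIZE LETTER AND JOINT CONTINUITY.**  For a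
setting with the standing hypotheses and the printed `Definitions`: the history-explicit smoothness clause `BetaSmoothInLast264 γ S.β`
(p. 264 «It is a smooth function defined on the interval [0, γ]») and the j- and history-UNIFORM reading
`BetaDerivsUniformInLast264 γ S.β b·` of «uniformly bounded on this interval together with all derivatives» (ONE table of constants
for all scales and frozen histories — a typed READING, `B12CouplingClausesHistory` §6) give (U) = order 0 (`betaUpperH_of_uniform`)
and (L@0) with `C = b 1` = order 1 (`lastVarLipschitz_of_uniform` + `BetaDerivClause.atZero_of_lastVarLipschitz`); hence with
(AF-0@face) `2b_AF ≤ β_{k+1}(g₀, …, g_{k−1}, 0)` on ]0, γ]^{k+1}, `b(1)·γ ≤ b_AF` (b_AF > 0) and joint continuity (C):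
`Theorem2Statement S hL` (`theorem2Statement_of_faceLetters`).  NOT in print under any reading: (AF-0@face) and (C) in the earlier
couplings.  A REDUCTION; nothing of [I] asserted; (D4) NOT discharged. [cite: Balaban1987RG1, Thm 2 (0.31) p.259 with p.264 (β-clause after (1.22)) and p.298] -/
theorem theorem2Statement_of_uniform264 (hH : StandingHypotheses S) (hD : Definitions S) {γ b : ℝ} {bt : ℕ → ℝ}
    (hγ0 : 0 < γ) (hb : 0 < b) (hS : BetaSmoothInLast264 γ S.β) (h264 : BetaDerivsUniformInLast264 γ S.β bt)
    (hAF0 : ∀ (k : ℕ) (p : Fin (k + 1) → ℝ), p ∈ B12Beta.HistBox γ k →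
      2 * b ≤ S.β k (Function.update p (Fin.last k) 0))
    (hγb : bt 1 * γ ≤ b) (hcont : BetaContH γ S.β) : Theorem2Statement S (hL_of_standing hH) :=
  have hLip : LastVarLipschitzAtZero S.β (bt 1) γ :=
    BetaDerivClause.atZero_of_lastVarLipschitz (lastVarLipschitz_of_uniform hS h264)
  have hC : 0 ≤ bt 1 :=
    have hmem : (fun _ : Fin (0 + 1) => γ) ∈ Box γ 0 := mem_box.mpr fun _ => ⟨hγ0, le_rfl⟩
    (norm_nonneg _).trans (h264 1 0 _ hmem γ ⟨hγ0.le, le_rfl⟩)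
  theorem2Statement_of_faceLetters hH hD hγ0 hb hAF0 hLip hC hγb (betaUpperH_of_uniform h264) hcont

end Summit.QuantumFields.BalabanUV.Beta.B12AsPrintedRowD4JunctionThm2

end
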